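import Literature.RingTheory.HilbertSamuel.InitialFormOfElement
import HarnessLib

/-!
# Crux `Steer` (stmt-ResolutionOfSingularities-16345), chain W4.1 — K-β0(b) gr bridge, brick (G1):
# a CONGRUENCE `f ≡ F(x) (mod 𝔪^(v+1))` pins the order and the initial form (run ↔ `in_𝔪` dictionary)

OURS (campaign `res-hironaka`, rung L ★L-G4, slot W4.1; seat res-L0-w41-stub-4 g7 on res-L0-w41-plan-1 RULINGS 262/268(a) «gr bridge»). Replaces the
role of no printed item; NOT a statement of the manuscript under review [claim: Hironaka2017, status: under-review]; AI-produced, weaker than expert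
review. Theses-free, definition-free, words-free. Currency: the tree's `Literature.RingTheory.HilbertSamuel` (`mOrder`, `initialFormsOf`,
`inForm`, `symbolForms`; CJS §2.2).

The run words state cones as CONGRUENCES (`BinaryConeAt`, `ArithBinaryResidueAt`, `IsArithStage`: `f − Ψ(m₁, m₂) ∈ 𝔪^(d+1)`); the gr bridge
reads them as INITIAL FORMS. This file is the dictionary:
* `exists_form_of_mem_pow_succ` — `r ∈ 𝔪^(v+1)` is the value of a form of degree `v` with coefficients in `𝔪` (reduction `0`).
* `mem_initialFormsOf_of_sub_eval_mem` — `f − F(x) ∈ 𝔪^(v+1)` ⇒ `F̄ ∈ initialFormsOf x f v` (any local ring, `x` generating `𝔪`).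
* `not_mem_pow_succ_of_sub_eval_mem` — … and if `F̄ ∉ W_v` then `f ∉ 𝔪^(v+1)`; for `R` REGULAR with r.s.o.p. `x` (`W_v = 0`):
  **`mOrder_eq_of_congruence`** (`F̄ ≠ 0 ⇒ v_𝔪(f) = v`) and **`inForm_eq_of_congruence`** (`in_𝔪(f) = F̄`).

[cite: CossartJannsenSaito2020, §2.2 (p. 24)] [folklore]
bears_on: LADDER-RESOLUTION L ★L-G4 W4.1 (crux `Steer`, binder hK4ⁿᶜ, K-β0(b) `ArithTransportTwoN`, gr bridge (G1)).
-/

noncomputable section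

-- `Summit.<S>.<S>.…` duplicates the summit name by design (single-problem summit).
set_option linter.dupNamespace false

open IsLocalRing MvPolynomial
open Literature.RingTheory.HilbertSamuel Literature.AlgebraicGeometry.Resolution

namespace Summit.ResolutionOfSingularities.ResolutionOfSingularities.Theorems.SwitchingDichotomy.NearPoint

universe u

section Local
variable {A : Type u} [CommRing A] [IsLocalRing A] {e : ℕ} (x : Fin e → A) (hx : Ideal.span (Set.range x) = maximalIdeal A)

include hx in
/-- **`r ∈ 𝔪^(v+1)` is the value of a form of degree `v` whose coefficients lie in `𝔪`** (so its reduction is `0`). -/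
theorem exists_form_of_mem_pow_succ (v : ℕ) (r : A) (hr : r ∈ maximalIdeal A ^ (v + 1)) :
    ∃ H : MvPolynomial (Fin e) A, H.IsHomogeneous v ∧ eval x H = r ∧ MvPolynomial.map (residue A) H = 0 := by
  classical
  rw [pow_succ] at hr
  refine Submodule.mul_induction_on hr (fun a ha b hb => ?_) (fun a b ⟨Ha, hHa, hae, hHa0⟩ ⟨Hb, hHb, hbe, hHb0⟩ => ?_)
  · rw [← hx] at ha
    obtain ⟨F, hF, hFa⟩ := exists_isHomogeneous_of_mem_span_pow x v ha
    refine ⟨MvPolynomial.C b * F, ?_, by rw [map_mul, eval_C, hFa, mul_comm], ?_⟩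
    · simpa using (isHomogeneous_C (Fin e) b).mul hF
    · rw [map_mul, map_C, (residue_eq_zero_iff b).mpr hb, C_0, zero_mul]
  · exact ⟨Ha + Hb, hHa.add hHb, by rw [map_add, hae, hbe], by rw [map_add, hHa0, hHb0, add_zero]⟩

include hx in
/-- **A congruence is an initial form**: `f − F(x) ∈ 𝔪^(v+1)` for a form `F` of degree `v` ⇒ `F̄ ∈ initialFormsOf x f v`. -/
theorem mem_initialFormsOf_of_sub_eval_mem (v : ℕ) (F : MvPolynomial (Fin e) A) (hF : F.IsHomogeneous v) (f : A)
    (hf : f - eval x F ∈ maximalIdeal A ^ (v + 1)) :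
    MvPolynomial.map (residue A) F ∈ initialFormsOf x f v := by
  obtain ⟨H, hH, hHe, hH0⟩ := exists_form_of_mem_pow_succ x hx v _ hf
  refine ⟨F + H, hF.add hH, by rw [map_add, hHe, add_sub_cancel], by rw [map_add, hH0, add_zero]⟩

include hx in
/-- … hence `f ∈ 𝔪^(v+1)` iff `F̄ ∈ W_v` (tree `mem_pow_succ_iff_of_mem_initialFormsOf`). -/
theorem mem_pow_succ_iff_of_sub_eval_mem (v : ℕ) (F : MvPolynomial (Fin e) A) (hF : F.IsHomogeneous v) (f : A)
    (hf : f - eval x F ∈ maximalIdeal A ^ (v + 1)) :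
    f ∈ maximalIdeal A ^ (v + 1) ↔ MvPolynomial.map (residue A) F ∈ symbolForms x hx v :=
  mem_pow_succ_iff_of_mem_initialFormsOf x hx (mem_initialFormsOf_of_sub_eval_mem x hx v F hF f hf)

end Local

section Regular
variable {R : Type u} [CommRing R] [IsRegularLocalRing R] {d : ℕ} (hd : (maximalIdeal R).spanFinrank = d) (x : Fin d → R)
  (hx : Ideal.span (Set.range x) = maximalIdeal R)

include hd hx in
/-- **Order from a congruence** (regular local ring, r.s.o.p. `x`): `f − F(x) ∈ 𝔪^(v+1)` with `F̄ ≠ 0` ⇒ `v_𝔪(f) = v`. -/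
theorem mOrder_eq_of_congruence (v : ℕ) (F : MvPolynomial (Fin d) R) (hF : F.IsHomogeneous v) (hF0 : MvPolynomial.map (residue R) F ≠ 0)
    (f : R) (hf : f - eval x F ∈ maximalIdeal R ^ (v + 1)) : mOrder f = v := by
  rw [mOrder_eq_natCast_iff]
  constructor
  · have hFx : eval x F ∈ maximalIdeal R ^ v :=
      (initialFormsOf_nonempty_iff x hx (eval x F) v).mp ⟨_, F, hF, rfl, rfl⟩
    have : f = eval x F + (f - eval x F) := by ring
    rw [this]
    exact Ideal.add_mem _ hFx (Ideal.pow_le_pow_right (Nat.le_succ v) hf)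
  · intro hmem
    have hW := (mem_pow_succ_iff_of_sub_eval_mem x hx v F hF f hf).mp hmem
    have hbot : symbolForms x hx v = ⊥ := by
      have := tangentConeIdeal_eq_bot_of_isRegularLocalRing hd x hx
      rw [tangentConeIdeal, Ideal.span_eq_bot] at this
      exact (Submodule.eq_bot_iff _).mpr fun w hw => this w (Set.mem_iUnion.mpr ⟨v, hw⟩)
    rw [hbot, Submodule.mem_bot] at hW
    exact hF0 hW

include hd hx in
/-- **Initial form from a congruence** (regular local ring, r.s.o.p. `x`): `f − F(x) ∈ 𝔪^(v+1)` with `F̄ ≠ 0` ⇒ `in_𝔪(f) = F̄`. -/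
theorem inForm_eq_of_congruence (v : ℕ) (F : MvPolynomial (Fin d) R) (hF : F.IsHomogeneous v) (hF0 : MvPolynomial.map (residue R) F ≠ 0)
    (f : R) (hf : f - eval x F ∈ maximalIdeal R ^ (v + 1)) : inForm x f = MvPolynomial.map (residue R) F := by
  have hv := mOrder_eq_of_congruence hd x hx v F hF hF0 f hf
  have hf0 : f ≠ 0 := by
    intro h0
    rw [h0, (mOrder_eq_top_iff_eq_zero (0 : R)).mpr rfl] at hv
    exact ENat.top_ne_coe v hv
  refine (eq_inForm_of_mem_initialFormsOf hd x hx hf0 ?_).symm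
  rw [hv, ENat.toNat_coe]
  exact mem_initialFormsOf_of_sub_eval_mem x hx v F hF f hf

end Regular

end Summit.ResolutionOfSingularities.ResolutionOfSingularities.Theorems.SwitchingDichotomy.NearPoint

end
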